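import Summits.HodgeConjecture.HodgeConjecture.Theorems.HLiu418E2DiscSlice
import HarnessLib

/-!
# Crux `HLiu418`, K-lane E₂ — frame geometry of a rank-2 cone frame WITHOUT hermitian symmetry, II: the ROTATIONS `k_w` and the BOOSTS
# `u_z` of `U(σ_{w₁}J)(ℂ)`, the boost absorbing the slice, conjugation by rotations, and the slice coordinates of every `u ∈ U`

Cell `hodgecm-mathlib`, FLOOR 0, programme P5 (`F0_AlbCm`); crux item `stmt-HodgeConjecture-24832`; seat F0P5-p02 (g2),
`--supports stmt-HodgeConjecture-24832` (helper).  THEOREMS ONLY (existential statements; no definition, no instance, no notation, no `sorry`).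
Continues ★-candidate `Theorems/HLiu418E2DiscSlice` (frame `𝔣 = (v₀,t₀)`, hypotheses `⟪v₀,t₀⟫ = 0` (`hvt`) and `⟪v₀,v₀⟫ = −r⟪t₀,t₀⟫`, `r > 0`
(`hvv`) in place of hermitian symmetry of `σ_{w₁}J`):
* §3 matrices with prescribed frame values; `⟪a t₀ + b v₀, a' t₀ + b' v₀⟫ = ā a' ⟪t₀,t₀⟫ + b̄ b' ⟪v₀,v₀⟫`; packaging into `U = archLocal E 2 J w₁`;
  the ROTATIONS: for `|w| = 1` an element `k_w ∈ U` with `k_w t₀ = w t₀`, `k_w v₀ = v₀` (an element of `K_∞ = U ∩ Stab(ℂ v₀)`, cotangent character `w`);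
* §4 the BOOSTS: for `|z|² < r`, `ν > 0`, `ν² r = r − |z|²` an element `u_z ∈ U` with `u_z t₀ = ν⁻¹ (t₀ + (z̄/r) v₀)`, `u_z v₀ = ν⁻¹ (z t₀ + v₀)` and the
  frame values of `u_z⁻¹`; `u_z⁻¹ (v₀ + z t₀) = ν v₀` (so `b_z := u_z⁻¹ s(z)` has cotangent multiplier `ν⁻²`); `k_w u_z k_w⁻¹ = u_{wz}`; and every
  `u ∈ U` has `u v₀ = q (v₀ + z t₀)` with `q ≠ 0`, `|z|² < r`.
Consumed by ★-candidate `Theorems/HLiu418E2ArchOrthHol` (S2⁺₂ `ArchOrthHolType₂` by the disc identity).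
HONEST LABEL: HC_CM is proved only modulo the 7 printed citations until rung 0 closes; this file discharges none of them.

## References
* [Borel1997] A. Borel, *Automorphic forms on SL₂(ℝ)* (1997), §5.13–§5.14 (automorphy factors on the disc).
* [BergeronMillsonMoeglin2016Balls] N. Bergeron, J. Millson, C. Moeglin, Acta Math. 216 (2016), Part 2 §1.3 (negative lines).
* [Jacobson] N. Jacobson, *Basic Algebra I*, Ch. V §7, §11 (hermitian forms, unitary groups).
-/

set_option autoImplicit false
-- the mandated namespace has the single-problem summit's repeated segment (`HodgeConjecture.HodgeConjecture`)
set_option linter.dupNamespace false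

noncomputable section

open Matrix NumberField NumberField.InfinitePlace
open scoped Matrix ComplexConjugate ComplexOrder
open Literature.NumberTheory.Automorphic Literature.NumberTheory.Automorphic.UnitaryGroup
open Literature.NumberTheory.Automorphic.UnitaryCurveForms
open Literature.AlgebraicGeometry.ShimuraVarieties Literature.AlgebraicGeometry.ShimuraVarieties.UnitaryCurveCone
open Summit.HodgeConjecture.HodgeConjecture.Cruxes.HLiu418.E2DiscSlice

namespace Summit.HodgeConjecture.HodgeConjecture.Cruxes.HLiu418.E2DiscBoost

variable {E : Type} [Field E] {J : Matrix (Fin 2) (Fin 2) E} {w₁ : {w : InfinitePlace E // IsComplex w}} (𝔣 : ConeFrame E J w₁)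

/-! ## §3 Matrices with prescribed frame values; the sesquilinear form on frame combinations; ROTATIONS -/

/-- A matrix with PRESCRIBED values on the frame: `M t₀ = p`, `M v₀ = q` (`M = p ⊗ ℓ_t + q ⊗ ℓ_v` with the coordinate functionals
`ℓ_t = ⟪t₀,t₀⟫⁻¹ t₀ᴴ σJ`, `ℓ_v = ⟪v₀,v₀⟫⁻¹ v₀ᴴ σJ`). [cite: Jacobson, Ch. V §7 pp. 150–151] -/
theorem exists_matrix_frame_values (hvt : star 𝔣.v₀ ⬝ᵥ (J.map w₁.1.embedding *ᵥ 𝔣.t₀) = 0) (p q : Fin 2 → ℂ) :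
    ∃ M : Matrix (Fin 2) (Fin 2) ℂ, M *ᵥ 𝔣.t₀ = p ∧ M *ᵥ 𝔣.v₀ = q := by
  set M : Matrix (Fin 2) (Fin 2) ℂ :=
    vecMulVec p ((star 𝔣.t₀ ⬝ᵥ (J.map w₁.1.embedding *ᵥ 𝔣.t₀))⁻¹ • (star 𝔣.t₀ ᵥ* J.map w₁.1.embedding)) +
      vecMulVec q ((star 𝔣.v₀ ⬝ᵥ (J.map w₁.1.embedding *ᵥ 𝔣.v₀))⁻¹ • (star 𝔣.v₀ ᵥ* J.map w₁.1.embedding)) with hM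
  have hMx : ∀ x, M *ᵥ x = ((star 𝔣.t₀ ⬝ᵥ (J.map w₁.1.embedding *ᵥ 𝔣.t₀))⁻¹ * (star 𝔣.t₀ ⬝ᵥ (J.map w₁.1.embedding *ᵥ x))) • p +
      ((star 𝔣.v₀ ⬝ᵥ (J.map w₁.1.embedding *ᵥ 𝔣.v₀))⁻¹ * (star 𝔣.v₀ ⬝ᵥ (J.map w₁.1.embedding *ᵥ x))) • q := fun x => by
    rw [hM, add_mulVec, Matrix.vecMulVec_mulVec, Matrix.vecMulVec_mulVec, op_smul_eq_smul, op_smul_eq_smul, smul_dotProduct,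
      smul_dotProduct, ← dotProduct_mulVec, ← dotProduct_mulVec, smul_eq_mul, smul_eq_mul]
  refine ⟨M, ?_, ?_⟩
  · rw [hMx, hvt, mul_zero, zero_smul, add_zero, inv_mul_cancel₀ (form_t₀_ne_zero 𝔣), one_smul]
  · rw [hMx, 𝔣.orth, mul_zero, zero_smul, zero_add, inv_mul_cancel₀ (form_v₀_ne_zero 𝔣), one_smul]

/-- **The form on frame combinations**: `⟪a t₀ + b v₀, a' t₀ + b' v₀⟫ = ā a' ⟪t₀,t₀⟫ + b̄ b' ⟪v₀,v₀⟫`. [cite: Jacobson, Ch. V §7 pp. 150–151] -/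
theorem form_combination (hvt : star 𝔣.v₀ ⬝ᵥ (J.map w₁.1.embedding *ᵥ 𝔣.t₀) = 0) (a b a' b' : ℂ) :
    star (a • 𝔣.t₀ + b • 𝔣.v₀) ⬝ᵥ (J.map w₁.1.embedding *ᵥ (a' • 𝔣.t₀ + b' • 𝔣.v₀)) =
      starRingEnd ℂ a * a' * (star 𝔣.t₀ ⬝ᵥ (J.map w₁.1.embedding *ᵥ 𝔣.t₀)) +
        starRingEnd ℂ b * b' * (star 𝔣.v₀ ⬝ᵥ (J.map w₁.1.embedding *ᵥ 𝔣.v₀)) := by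
  simp only [star_add, star_smul, add_dotProduct, smul_dotProduct, mulVec_add, mulVec_smul, dotProduct_add, dotProduct_smul,
    smul_eq_mul, hvt, 𝔣.orth, mul_zero, add_zero, zero_add, Complex.star_def]
  ring

/-- Packaging a matrix with a two-sided inverse and `gᴴ σJ g = σJ` as an element of `U = archLocal E 2 J w₁` with prescribed matrix.
[cite: Jacobson, Ch. V §11 p. 162] -/
theorem exists_archLocal_of_inverse {g g' : Matrix (Fin 2) (Fin 2) ℂ} (h1 : g * g' = 1) (h2 : g' * g = 1)
    (hu : gᴴ * J.map w₁.1.embedding * g = J.map w₁.1.embedding) :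
    ∃ u : archLocal E 2 J w₁, ((u : GL (Fin 2) ℂ) : Matrix (Fin 2) (Fin 2) ℂ) = g :=
  ⟨⟨⟨g, g', h1, h2⟩, (mem_archLocal_iff_conjTranspose E 2 J w₁ _).2 hu⟩, rfl⟩

/-- **ROTATIONS**: for `|w| = 1` there is `k_w ∈ U` with `k_w t₀ = w t₀`, `k_w v₀ = v₀` (an element of `K_∞ = U ∩ Stab(ℂ v₀)` with cotangent
character `w`). [cite: Borel1997, §5.13–§5.14] -/
theorem exists_rotation (hvt : star 𝔣.v₀ ⬝ᵥ (J.map w₁.1.embedding *ᵥ 𝔣.t₀) = 0) (w : ℂ) (hw : ‖w‖ = 1) :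
    ∃ k : archLocal E 2 J w₁, ((k : GL (Fin 2) ℂ) : Matrix (Fin 2) (Fin 2) ℂ) *ᵥ 𝔣.t₀ = w • 𝔣.t₀ ∧
      ((k : GL (Fin 2) ℂ) : Matrix (Fin 2) (Fin 2) ℂ) *ᵥ 𝔣.v₀ = 𝔣.v₀ := by
  have hw0 : w ≠ 0 := fun h => by rw [h, norm_zero] at hw; exact zero_ne_one hw
  have hww : starRingEnd ℂ w * w = 1 := by rw [Complex.conj_mul' w, hw]; norm_num
  obtain ⟨K, hKt, hKv⟩ := exists_matrix_frame_values 𝔣 hvt (w • 𝔣.t₀) 𝔣.v₀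
  obtain ⟨K', hK't, hK'v⟩ := exists_matrix_frame_values 𝔣 hvt (w⁻¹ • 𝔣.t₀) 𝔣.v₀
  have h1 : K * K' = 1 := matrix_eq_of_frame 𝔣 hvt
    (by rw [← mulVec_mulVec, hK't, mulVec_smul, hKt, smul_smul, inv_mul_cancel₀ hw0, one_smul, one_mulVec])
    (by rw [← mulVec_mulVec, hK'v, hKv, one_mulVec])
  have h2 : K' * K = 1 := matrix_eq_of_frame 𝔣 hvt
    (by rw [← mulVec_mulVec, hKt, mulVec_smul, hK't, smul_smul, mul_inv_cancel₀ hw0, one_smul, one_mulVec])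
    (by rw [← mulVec_mulVec, hKv, hK'v, one_mulVec])
  have hu : Kᴴ * J.map w₁.1.embedding * K = J.map w₁.1.embedding := by
    refine conjTranspose_mul_mul_eq_of_frame 𝔣 hvt ?_ ?_ ?_ ?_
    · rw [hKt, star_smul, smul_dotProduct, mulVec_smul, dotProduct_smul, smul_eq_mul, smul_eq_mul, ← mul_assoc, Complex.star_def,
        hww, one_mul]
    · rw [hKt, hKv, star_smul, smul_dotProduct, 𝔣.orth, smul_zero]
    · rw [hKt, hKv, mulVec_smul, dotProduct_smul, hvt, smul_zero]
    · rw [hKv]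
  obtain ⟨k, hk⟩ := exists_archLocal_of_inverse (w₁ := w₁) h1 h2 hu
  exact ⟨k, by rw [hk, hKt], by rw [hk, hKv]⟩

/-! ## §4 BOOSTS, the factorisation of the slice, conjugation by rotations, and the factorisation of `U` through boosts -/

section Boost

variable {r : ℝ} {z : ℂ} {ν : ℝ}

/-- The real identity `ν² r = r − |z|²` in complex form. [cite: Borel1997, §5.13–§5.14] -/
theorem boost_scalar_identity (hν2 : ν ^ 2 * r = r - ‖z‖ ^ 2) : ((ν : ℂ)) ^ 2 * (r : ℂ) = (r : ℂ) - starRingEnd ℂ z * z := by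
  rw [Complex.conj_mul' z]
  exact_mod_cast hν2

/-- **BOOSTS**: for `|z|² < r` and `ν > 0` with `ν² r = r − |z|²` there is `u_z ∈ U` with `u_z t₀ = ν⁻¹ (t₀ + (z̄/r) v₀)` and
`u_z v₀ = ν⁻¹ (v₀ + z t₀)`; its inverse is the boost at `−z`. [cite: Borel1997, §5.13–§5.14] [cite: Jacobson, Ch. V §11 p. 162] -/
theorem exists_boost (hvt : star 𝔣.v₀ ⬝ᵥ (J.map w₁.1.embedding *ᵥ 𝔣.t₀) = 0) (hr : 0 < r)
    (hvv : star 𝔣.v₀ ⬝ᵥ (J.map w₁.1.embedding *ᵥ 𝔣.v₀) = -(r : ℂ) * (star 𝔣.t₀ ⬝ᵥ (J.map w₁.1.embedding *ᵥ 𝔣.t₀)))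
    (hν : 0 < ν) (hν2 : ν ^ 2 * r = r - ‖z‖ ^ 2) :
    ∃ u : archLocal E 2 J w₁,
      ((u : GL (Fin 2) ℂ) : Matrix (Fin 2) (Fin 2) ℂ) *ᵥ 𝔣.t₀ = (ν : ℂ)⁻¹ • 𝔣.t₀ + ((ν : ℂ)⁻¹ * (starRingEnd ℂ z / r)) • 𝔣.v₀ ∧
      ((u : GL (Fin 2) ℂ) : Matrix (Fin 2) (Fin 2) ℂ) *ᵥ 𝔣.v₀ = ((ν : ℂ)⁻¹ * z) • 𝔣.t₀ + (ν : ℂ)⁻¹ • 𝔣.v₀ ∧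
      (((u⁻¹ : archLocal E 2 J w₁) : GL (Fin 2) ℂ) : Matrix (Fin 2) (Fin 2) ℂ) *ᵥ 𝔣.t₀ =
        (ν : ℂ)⁻¹ • 𝔣.t₀ + (-((ν : ℂ)⁻¹ * (starRingEnd ℂ z / r))) • 𝔣.v₀ ∧
      (((u⁻¹ : archLocal E 2 J w₁) : GL (Fin 2) ℂ) : Matrix (Fin 2) (Fin 2) ℂ) *ᵥ 𝔣.v₀ = (-((ν : ℂ)⁻¹ * z)) • 𝔣.t₀ + (ν : ℂ)⁻¹ • 𝔣.v₀ := by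
  have hr0 : (r : ℂ) ≠ 0 := Complex.ofReal_ne_zero.2 hr.ne'
  have hν0 : (ν : ℂ) ≠ 0 := Complex.ofReal_ne_zero.2 hν.ne'
  have hid := boost_scalar_identity hν2
  have hT := form_t₀_ne_zero 𝔣
  set c : ℂ := starRingEnd ℂ z / r with hc
  obtain ⟨U, hUt, hUv⟩ := exists_matrix_frame_values 𝔣 hvt ((ν : ℂ)⁻¹ • 𝔣.t₀ + ((ν : ℂ)⁻¹ * c) • 𝔣.v₀)
    (((ν : ℂ)⁻¹ * z) • 𝔣.t₀ + (ν : ℂ)⁻¹ • 𝔣.v₀)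
  obtain ⟨U', hU't, hU'v⟩ := exists_matrix_frame_values 𝔣 hvt ((ν : ℂ)⁻¹ • 𝔣.t₀ + (-((ν : ℂ)⁻¹ * c)) • 𝔣.v₀)
    ((-((ν : ℂ)⁻¹ * z)) • 𝔣.t₀ + (ν : ℂ)⁻¹ • 𝔣.v₀)
  -- the key scalars: `c r = z̄`, `(z/r) r = z`, `ν⁻² ν² = 1`, `ν² = 1 - c z`, `ν⁻² (1 - c z) = 1`
  have hd : c * r = starRingEnd ℂ z := by rw [hc]; exact div_mul_cancel₀ _ hr0
  have hd' : z / (r : ℂ) * r = z := div_mul_cancel₀ _ hr0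
  have hmm : (ν : ℂ)⁻¹ * (ν : ℂ)⁻¹ * (ν : ℂ) ^ 2 = 1 := by
    rw [show (ν : ℂ)⁻¹ * (ν : ℂ)⁻¹ * (ν : ℂ) ^ 2 = ((ν : ℂ)⁻¹ * ν) * ((ν : ℂ)⁻¹ * ν) by ring, inv_mul_cancel₀ hν0, one_mul]
  have h1cz : (ν : ℂ) ^ 2 = 1 - c * z :=
    mul_right_cancel₀ hr0 (by rw [hid]; linear_combination z * hd)
  have hcz : (ν : ℂ)⁻¹ * (ν : ℂ)⁻¹ * (1 - c * z) = 1 := by rw [← h1cz]; exact hmm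
  -- products on the frame
  have hUU't : (U * U') *ᵥ 𝔣.t₀ = 𝔣.t₀ := by
    rw [← mulVec_mulVec, hU't, mulVec_add, mulVec_smul, mulVec_smul, hUt, hUv]
    have : (ν : ℂ)⁻¹ • ((ν : ℂ)⁻¹ • 𝔣.t₀ + ((ν : ℂ)⁻¹ * c) • 𝔣.v₀) + -((ν : ℂ)⁻¹ * c) • (((ν : ℂ)⁻¹ * z) • 𝔣.t₀ + (ν : ℂ)⁻¹ • 𝔣.v₀) =
        ((ν : ℂ)⁻¹ * (ν : ℂ)⁻¹ * (1 - c * z)) • 𝔣.t₀ := by module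
    rw [this, hcz, one_smul]
  have hUU'v : (U * U') *ᵥ 𝔣.v₀ = 𝔣.v₀ := by
    rw [← mulVec_mulVec, hU'v, mulVec_add, mulVec_smul, mulVec_smul, hUt, hUv]
    have : -((ν : ℂ)⁻¹ * z) • ((ν : ℂ)⁻¹ • 𝔣.t₀ + ((ν : ℂ)⁻¹ * c) • 𝔣.v₀) + (ν : ℂ)⁻¹ • (((ν : ℂ)⁻¹ * z) • 𝔣.t₀ + (ν : ℂ)⁻¹ • 𝔣.v₀) =
        ((ν : ℂ)⁻¹ * (ν : ℂ)⁻¹ * (1 - c * z)) • 𝔣.v₀ := by module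
    rw [this, hcz, one_smul]
  have hU'Ut : (U' * U) *ᵥ 𝔣.t₀ = 𝔣.t₀ := by
    rw [← mulVec_mulVec, hUt, mulVec_add, mulVec_smul, mulVec_smul, hU't, hU'v]
    have : (ν : ℂ)⁻¹ • ((ν : ℂ)⁻¹ • 𝔣.t₀ + -((ν : ℂ)⁻¹ * c) • 𝔣.v₀) + ((ν : ℂ)⁻¹ * c) • (-((ν : ℂ)⁻¹ * z) • 𝔣.t₀ + (ν : ℂ)⁻¹ • 𝔣.v₀) =
        ((ν : ℂ)⁻¹ * (ν : ℂ)⁻¹ * (1 - c * z)) • 𝔣.t₀ := by module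
    rw [this, hcz, one_smul]
  have hU'Uv : (U' * U) *ᵥ 𝔣.v₀ = 𝔣.v₀ := by
    rw [← mulVec_mulVec, hUv, mulVec_add, mulVec_smul, mulVec_smul, hU't, hU'v]
    have : ((ν : ℂ)⁻¹ * z) • ((ν : ℂ)⁻¹ • 𝔣.t₀ + -((ν : ℂ)⁻¹ * c) • 𝔣.v₀) + (ν : ℂ)⁻¹ • (-((ν : ℂ)⁻¹ * z) • 𝔣.t₀ + (ν : ℂ)⁻¹ • 𝔣.v₀) =
        ((ν : ℂ)⁻¹ * (ν : ℂ)⁻¹ * (1 - c * z)) • 𝔣.v₀ := by module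
    rw [this, hcz, one_smul]
  have h1 : U * U' = 1 := matrix_eq_of_frame 𝔣 hvt (by rw [hUU't, one_mulVec]) (by rw [hUU'v, one_mulVec])
  have h2 : U' * U = 1 := matrix_eq_of_frame 𝔣 hvt (by rw [hU'Ut, one_mulVec]) (by rw [hU'Uv, one_mulVec])
  -- unitarity on frame pairs
  have hνc : starRingEnd ℂ ((ν : ℂ)⁻¹) = (ν : ℂ)⁻¹ := by rw [map_inv₀, Complex.conj_ofReal]
  have hcc : starRingEnd ℂ c = z / r := by rw [hc, map_div₀, Complex.conj_conj, Complex.conj_ofReal]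
  have hu : Uᴴ * J.map w₁.1.embedding * U = J.map w₁.1.embedding := by
    refine conjTranspose_mul_mul_eq_of_frame 𝔣 hvt ?_ ?_ ?_ ?_
    · rw [hUt, form_combination 𝔣 hvt, hvv, map_mul, hνc, hcc]
      linear_combination (star 𝔣.t₀ ⬝ᵥ (J.map w₁.1.embedding *ᵥ 𝔣.t₀)) * hcz -
        ((ν : ℂ)⁻¹ * (ν : ℂ)⁻¹ * c * (star 𝔣.t₀ ⬝ᵥ (J.map w₁.1.embedding *ᵥ 𝔣.t₀))) * hd'
    · rw [hUt, hUv, form_combination 𝔣 hvt, hvv, map_mul, hνc, hcc]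
      linear_combination (-((ν : ℂ)⁻¹ * (ν : ℂ)⁻¹ * (star 𝔣.t₀ ⬝ᵥ (J.map w₁.1.embedding *ᵥ 𝔣.t₀)))) * hd'
    · rw [hUt, hUv, form_combination 𝔣 hvt, hvv, map_mul, hνc]
      linear_combination (-((ν : ℂ)⁻¹ * (ν : ℂ)⁻¹ * (star 𝔣.t₀ ⬝ᵥ (J.map w₁.1.embedding *ᵥ 𝔣.t₀)))) * hd
    · rw [hUv, form_combination 𝔣 hvt, hvv, map_mul, hνc]
      linear_combination ((ν : ℂ)⁻¹ * (ν : ℂ)⁻¹ * (star 𝔣.t₀ ⬝ᵥ (J.map w₁.1.embedding *ᵥ 𝔣.t₀))) * hid -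
        ((r : ℂ) * (star 𝔣.t₀ ⬝ᵥ (J.map w₁.1.embedding *ᵥ 𝔣.t₀))) * hmm
  obtain ⟨u, hu'⟩ := exists_archLocal_of_inverse (w₁ := w₁) h1 h2 hu
  have hinv : (((u⁻¹ : archLocal E 2 J w₁) : GL (Fin 2) ℂ) : Matrix (Fin 2) (Fin 2) ℂ) = U' := by
    have hmul : (((u⁻¹ : archLocal E 2 J w₁) : GL (Fin 2) ℂ) : Matrix (Fin 2) (Fin 2) ℂ) * U = 1 := by
      rw [← hu', Subgroup.coe_inv, ← Units.val_mul, inv_mul_cancel, Units.val_one]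
    calc (((u⁻¹ : archLocal E 2 J w₁) : GL (Fin 2) ℂ) : Matrix (Fin 2) (Fin 2) ℂ)
        = (((u⁻¹ : archLocal E 2 J w₁) : GL (Fin 2) ℂ) : Matrix (Fin 2) (Fin 2) ℂ) * (U * U') := by rw [h1, Matrix.mul_one]
      _ = U' := by rw [← Matrix.mul_assoc, hmul, Matrix.one_mul]
  exact ⟨u, by rw [hu', hUt], by rw [hu', hUv], by rw [hinv, hU't], by rw [hinv, hU'v]⟩

/-- **The boost absorbs the slice**: with the frame values of `u_z⁻¹` from `exists_boost`, `u_z⁻¹ (v₀ + z t₀) = ν v₀` — so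
`b_z := u_z⁻¹ s(z)` has frame coordinates `b_z v₀ = ν v₀`, `b_z t₀ = u_z⁻¹ t₀ = ν⁻¹ t₀ − (z̄/(rν)) v₀` and cotangent multiplier
`(ν⁻¹)(ν)⁻¹ = ν⁻²`. [cite: Borel1997, §5.13–§5.14] -/
theorem inv_boost_mulVec_slice (hr : 0 < r) (hν : 0 < ν) (hν2 : ν ^ 2 * r = r - ‖z‖ ^ 2) {U' : Matrix (Fin 2) (Fin 2) ℂ}
    (hU't : U' *ᵥ 𝔣.t₀ = (ν : ℂ)⁻¹ • 𝔣.t₀ + (-((ν : ℂ)⁻¹ * (starRingEnd ℂ z / r))) • 𝔣.v₀)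
    (hU'v : U' *ᵥ 𝔣.v₀ = (-((ν : ℂ)⁻¹ * z)) • 𝔣.t₀ + (ν : ℂ)⁻¹ • 𝔣.v₀) :
    U' *ᵥ (𝔣.v₀ + z • 𝔣.t₀) = (ν : ℂ) • 𝔣.v₀ := by
  have hr0 : (r : ℂ) ≠ 0 := Complex.ofReal_ne_zero.2 hr.ne'
  have hν0 : (ν : ℂ) ≠ 0 := Complex.ofReal_ne_zero.2 hν.ne'
  have hid := boost_scalar_identity hν2
  have hd : starRingEnd ℂ z / r * r = starRingEnd ℂ z := div_mul_cancel₀ _ hr0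
  -- `ν⁻¹ (1 - (z̄/r) z) = ν`
  have h1cz : (ν : ℂ) ^ 2 = 1 - starRingEnd ℂ z / r * z :=
    mul_right_cancel₀ hr0 (by rw [hid]; linear_combination z * hd)
  have hkey : (ν : ℂ)⁻¹ * (1 - starRingEnd ℂ z / r * z) = ν := by
    rw [← h1cz, pow_two, ← mul_assoc, inv_mul_cancel₀ hν0, one_mul]
  rw [mulVec_add, mulVec_smul, hU't, hU'v]
  have : -((ν : ℂ)⁻¹ * z) • 𝔣.t₀ + (ν : ℂ)⁻¹ • 𝔣.v₀ + z • ((ν : ℂ)⁻¹ • 𝔣.t₀ + -((ν : ℂ)⁻¹ * (starRingEnd ℂ z / ↑r)) • 𝔣.v₀) =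
      ((ν : ℂ)⁻¹ * (1 - starRingEnd ℂ z / r * z)) • 𝔣.v₀ := by module
  rw [this, hkey]

/-- **Conjugating a boost by a rotation**: `k_w u_z k_w⁻¹ = u_{wz}` (frame values match; matrices are determined on the frame).
[cite: Borel1997, §5.13–§5.14] -/
theorem rotation_mul_boost_mul_inv (hvt : star 𝔣.v₀ ⬝ᵥ (J.map w₁.1.embedding *ᵥ 𝔣.t₀) = 0) {w : ℂ} (hw : ‖w‖ = 1)
    {k u u' : archLocal E 2 J w₁}
    (hkt : ((k : GL (Fin 2) ℂ) : Matrix (Fin 2) (Fin 2) ℂ) *ᵥ 𝔣.t₀ = w • 𝔣.t₀)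
    (hkv : ((k : GL (Fin 2) ℂ) : Matrix (Fin 2) (Fin 2) ℂ) *ᵥ 𝔣.v₀ = 𝔣.v₀)
    (hut : ((u : GL (Fin 2) ℂ) : Matrix (Fin 2) (Fin 2) ℂ) *ᵥ 𝔣.t₀ = (ν : ℂ)⁻¹ • 𝔣.t₀ + ((ν : ℂ)⁻¹ * (starRingEnd ℂ z / r)) • 𝔣.v₀)
    (huv : ((u : GL (Fin 2) ℂ) : Matrix (Fin 2) (Fin 2) ℂ) *ᵥ 𝔣.v₀ = ((ν : ℂ)⁻¹ * z) • 𝔣.t₀ + (ν : ℂ)⁻¹ • 𝔣.v₀)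
    (hu't : ((u' : GL (Fin 2) ℂ) : Matrix (Fin 2) (Fin 2) ℂ) *ᵥ 𝔣.t₀ =
      (ν : ℂ)⁻¹ • 𝔣.t₀ + ((ν : ℂ)⁻¹ * (starRingEnd ℂ (w * z) / r)) • 𝔣.v₀)
    (hu'v : ((u' : GL (Fin 2) ℂ) : Matrix (Fin 2) (Fin 2) ℂ) *ᵥ 𝔣.v₀ = ((ν : ℂ)⁻¹ * (w * z)) • 𝔣.t₀ + (ν : ℂ)⁻¹ • 𝔣.v₀) :
    k * u * k⁻¹ = u' := by
  have hww : w * starRingEnd ℂ w = 1 := by rw [Complex.mul_conj' w, hw]; norm_num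
  rw [mul_inv_eq_iff_eq_mul]
  apply Subtype.ext
  apply Units.ext
  change ((k : GL (Fin 2) ℂ) : Matrix (Fin 2) (Fin 2) ℂ) * ((u : GL (Fin 2) ℂ) : Matrix (Fin 2) (Fin 2) ℂ) =
    ((u' : GL (Fin 2) ℂ) : Matrix (Fin 2) (Fin 2) ℂ) * ((k : GL (Fin 2) ℂ) : Matrix (Fin 2) (Fin 2) ℂ)
  refine matrix_eq_of_frame 𝔣 hvt ?_ ?_
  · rw [← mulVec_mulVec, ← mulVec_mulVec, hut, hkt, mulVec_add, mulVec_smul, mulVec_smul, hkt, hkv, mulVec_smul, hu't, map_mul]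
    have : ((ν : ℂ)⁻¹ * (starRingEnd ℂ w * starRingEnd ℂ z / ↑r)) = starRingEnd ℂ w * ((ν : ℂ)⁻¹ * (starRingEnd ℂ z / ↑r)) := by ring
    rw [this]
    have h2 : w • ((ν : ℂ)⁻¹ • 𝔣.t₀ + (starRingEnd ℂ w * ((ν : ℂ)⁻¹ * (starRingEnd ℂ z / ↑r))) • 𝔣.v₀) =
        (ν : ℂ)⁻¹ • (w • 𝔣.t₀) + ((w * starRingEnd ℂ w) * ((ν : ℂ)⁻¹ * (starRingEnd ℂ z / ↑r))) • 𝔣.v₀ := by module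
    rw [h2, hww, one_mul]
  · rw [← mulVec_mulVec, ← mulVec_mulVec, huv, hkv, mulVec_add, mulVec_smul, mulVec_smul, hkt, hkv, hu'v]
    module

/-- **Every `u ∈ U` points into the slice disc**: `u v₀ = q (v₀ + z t₀)` with `q ≠ 0` and `|z|² < r` (frame coordinates of the negative
vector `u v₀`). [cite: BergeronMillsonMoeglin2016Balls, Part 2 §1.3] -/
theorem exists_coords_of_archLocal (hvt : star 𝔣.v₀ ⬝ᵥ (J.map w₁.1.embedding *ᵥ 𝔣.t₀) = 0)
    (hvv : star 𝔣.v₀ ⬝ᵥ (J.map w₁.1.embedding *ᵥ 𝔣.v₀) = -(r : ℂ) * (star 𝔣.t₀ ⬝ᵥ (J.map w₁.1.embedding *ᵥ 𝔣.t₀)))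
    (u : archLocal E 2 J w₁) :
    ∃ z q : ℂ, ‖z‖ ^ 2 < r ∧ q ≠ 0 ∧ ((u : GL (Fin 2) ℂ) : Matrix (Fin 2) (Fin 2) ℂ) *ᵥ 𝔣.v₀ = q • (𝔣.v₀ + z • 𝔣.t₀) := by
  set P : ℂ := (star 𝔣.t₀ ⬝ᵥ (J.map w₁.1.embedding *ᵥ (((u : GL (Fin 2) ℂ) : Matrix (Fin 2) (Fin 2) ℂ) *ᵥ 𝔣.v₀))) *
    (star 𝔣.t₀ ⬝ᵥ (J.map w₁.1.embedding *ᵥ 𝔣.t₀))⁻¹ with hP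
  set Qv : ℂ := (star 𝔣.v₀ ⬝ᵥ (J.map w₁.1.embedding *ᵥ (((u : GL (Fin 2) ℂ) : Matrix (Fin 2) (Fin 2) ℂ) *ᵥ 𝔣.v₀))) *
    (star 𝔣.v₀ ⬝ᵥ (J.map w₁.1.embedding *ᵥ 𝔣.v₀))⁻¹ with hQv
  have hdec : ((u : GL (Fin 2) ℂ) : Matrix (Fin 2) (Fin 2) ℂ) *ᵥ 𝔣.v₀ = P • 𝔣.t₀ + Qv • 𝔣.v₀ := frame_decomp 𝔣 hvt _
  have hneg := (isUnit_and_mulVec_mem_negCone 𝔣 u).2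
  rw [mem_negCone_iff, hdec, form_combination 𝔣 hvt, hvv, Complex.conj_mul', Complex.conj_mul'] at hneg
  have hsum : ((‖P‖ : ℂ) ^ 2) * (star 𝔣.t₀ ⬝ᵥ (J.map w₁.1.embedding *ᵥ 𝔣.t₀)) +
      ((‖Qv‖ : ℂ) ^ 2) * (-(r : ℂ) * (star 𝔣.t₀ ⬝ᵥ (J.map w₁.1.embedding *ᵥ 𝔣.t₀))) =
      ((‖P‖ ^ 2 - r * ‖Qv‖ ^ 2 : ℝ) : ℂ) * (star 𝔣.t₀ ⬝ᵥ (J.map w₁.1.embedding *ᵥ 𝔣.t₀)) := by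
    push_cast
    ring
  rw [hsum, Complex.re_ofReal_mul] at hneg
  have hT := 𝔣.t₀_pos
  have hlt : ‖P‖ ^ 2 < r * ‖Qv‖ ^ 2 := by
    rcases mul_neg_iff.1 hneg with ⟨_, h2⟩ | ⟨h1, _⟩
    · exact absurd h2 (not_lt.2 hT.le)
    · exact sub_neg.1 h1
  have hQ0 : Qv ≠ 0 := by
    intro h0
    rw [h0, norm_zero] at hlt
    nlinarith [sq_nonneg ‖P‖]
  have hQn : 0 < ‖Qv‖ := norm_pos_iff.2 hQ0
  refine ⟨P / Qv, Qv, ?_, hQ0, ?_⟩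
  · rw [norm_div, div_pow, div_lt_iff₀ (by positivity)]
    linarith
  · rw [hdec, smul_add, smul_smul, mul_div_cancel₀ _ hQ0, add_comm]

end Boost

end Summit.HodgeConjecture.HodgeConjecture.Cruxes.HLiu418.E2DiscBoost

end
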